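import Literature.Geometry.Riemannian.ChangGurskyYangMinimumPrinciple
import Literature.Geometry.Riemannian.ChangGurskyYangSmoothness
import Literature.Geometry.Riemannian.YamabeBoundedBelow
import Literature.Geometry.Lorentzian.VolumePositivity
import Literature.Geometry.Lorentzian.ConformalChangeRicci
import HarnessLib

/-!
# Gursky–Viaclovsky 2003, §3: the `C⁰` estimates along the continuity path — the maximum-principle
# sup bound (Prop. 3), and the integral identity and Lemma 1 behind the inf bound (Prop. 4)

Gursky–Viaclovsky (J. Differential Geom. 63 (2003), §3) solve `σ₂^{1/2}(g⁻¹A^t_{u_t}) = f e^{2u_t}`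
along `t ∈ [δ, 1]` by the continuity method; the `C⁰` estimates are Prop. 3 (`u_t ≤ δ̄(g)`, by
the maximum principle and Newton's inequality) and Prop. 4 (`u_t > δ̲(g, C₁, log λ_t)`: integrate
the equation, Lemma 1 `∫R_{g'}² dV_{g'} ≥ Y[g]²`, the conformal invariance of `𝓕₂`, then a Harnack
step under the gradient bound `C₁`). This file proves, in the tree's Weyl-weighted vocabulary read
on the conformal metric `h = e^{−2u} g` (`GurskyViaclovskyPath.lean`: `pathOperator h t =
σ₂(A_h) − ¼|W_h|² + (1−t)(2−t)R_h²/6`, `IsPathSolution g h u t q` = "`h = e^{−2u}g` Riemannian,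
`u ∈ C^∞`, `R_h > 0`, `P_t(h) = q e^{8u}`", `kappa h = ∫σ₂(A_h) dV_h − ¼∫|W_h|² dV_h`), everything
short of the Harnack step:

* `IsPathSolution.mul_exp_le_of_isMaxOn` — **Prop. 3, pointwise**: at a maximum point `x₀` of `u`
  (`t ≤ 1`), `q(x₀)e^{4u(x₀)} ≤ R_g(x₀)²(1/24 + (1−t)(2−t)/6)` (`Δ_g e^{−u}(x₀) ≥ 0`,
  `dalembertian_nonneg_of_isLocalMin`; `0 < R_h = φ⁻³(R_gφ − 6Δ_gφ) ≤ e^{2u}R_g`,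
  `scalarCurvature_conformal_sq_four`; `σ₂(A_h) ≤ R_h²/24`, `|W_h|² ≥ 0`);
* `exists_forall_isPathSolution_le` — **Prop. 3**: on a compact `M⁴`, for continuous `q > 0` and
  `δ`, a constant `C(g, q, δ)` with `u ≤ C` for EVERY solution at any `t ∈ [δ, 1]`;
* `sq_integral_le_measureReal_mul_integral_sq` — `(∫f)² ≤ μ(X)∫f²`;
* `sq_yamabeConstant_le_integral_scalarCurvature_sq` — **Lemma 1**: `Y[g]² ≤ ∫R_h² dV_h` for
  `h ∈ [g]` when `Y[g] ≥ 0` (`yamabeConstant_le_yamabeQuotient` and Cauchy–Schwarz);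
* `IsPathSolution.integral_mul_exp_eq` — **the integral identity of Prop. 4**:
  `∫ q e^{4u} dV_g = κ(h) + ((1−t)(2−t)/6)∫R_h² dV_h` (`dV_h = e^{−4u}dV_g`,
  `riemannianMeasure_of_conformal`; `sigma2WeylSchoutenIntegral_eq`, `weylEnergy_eq_ofReal_integral`);
* `IsPathSolution.kappa_add_le_integral_mul_exp` — `κ(h) + ((1−t)(2−t)/6)Y[g]² ≤ ∫ q e^{4u} dV_g`
  for `t ≤ 1`, `Y[g] ≥ 0` (the source's "`C'∫e^{4u_t} ≥ λ_t`");
* `IsPathSolution.exists_log_le` — **the lower bound on `max u`**: if `κ(h) ≥ κ₀ > 0` then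
  `log(κ₀/∫q dV_g) ≤ 4u(x)` at some point.

With `IsPathSolution.kappa_eq` (`GurskyViaclovskyKappaInvariance.lean`: `κ` is constant along the
path) the hypothesis `κ(h) ≥ κ₀` is Chang–Gursky–Yang's `κ(g) > 0`. Everything is proved; no
definition and no named fact is introduced.

## References

* M. J. Gursky, J. A. Viaclovsky, *A fully nonlinear equation on four-manifolds with positive
  scalar curvature*, J. Differential Geom. 63 (2003) 131–154, §3: Prop. 3, Prop. 4 and its proof,
  Lemma 1. [GurskyViaclovsky2003]
* S.-Y. A. Chang, M. J. Gursky, P. C. Yang, *A conformally invariant sphere theorem in four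
  dimensions*, Publ. Math. IHÉS 98 (2003) 105–143, (1.10), p. 116 (the continuity method).
  [ChangGurskyYang2003]
-/

noncomputable section

open Bundle Finset Module MeasureTheory Set Filter Function
open scoped Manifold ContDiff Topology

namespace Literature.Geometry.Riemannian.GurskyViaclovskyPath

open Lorentzian Lorentzian.PseudoRiemannianMetric

section SupBound

variable {M : Type*} [TopologicalSpace M] [ChartedSpace (EuclideanSpace ℝ (Fin 4)) M]
  [IsManifold (𝓡 4) ∞ M]
  (g h : PseudoRiemannianMetric (𝓡 4) ∞ (EuclideanSpace ℝ (Fin 4)) (TangentSpace (𝓡 4) : M → Type _))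
  [g.HasLeviCivita] [h.HasLeviCivita]

/-- **Gursky–Viaclovsky's sup bound, pointwise form (2003, Prop. 3, with the Weyl weight).** For a
path solution `h = e^{−2u} g` at a parameter `t ≤ 1` with right-hand side `q`
(`IsPathSolution g h u t q`: `P_t(h) = σ₂(A_h) − ¼|W_h|² + (1−t)(2−t)R_h²/6 = q e^{8u}`, `R_h > 0`)
and a maximum point `x₀` of `u`,
`q(x₀) e^{4u(x₀)} ≤ R_g(x₀)² (1/24 + (1−t)(2−t)/6)`.
Proof (the printed one, read on `h`): at `x₀` the factor `φ = e^{−u}` has a minimum, so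
`Δ_g φ(x₀) ≥ 0` (`dalembertian_nonneg_of_isLocalMin`) and
`0 < R_h = φ⁻³(R_g φ − 6Δ_g φ) ≤ e^{2u} R_g` (`scalarCurvature_conformal_sq_four`; this is
"`σ₁(g⁻¹A^t_u)(p) = σ₁(g⁻¹A^t_g) + (3−2t)Δu ≤ σ₁(g⁻¹A^t_g)`" of the source); and
`q e^{8u} = P_t(h) ≤ R_h²/24 + (1−t)(2−t)R_h²/6` since `σ₂(A_h) = −½|E_h|² + R_h²/24 ≤ R_h²/24`
and `|W_h|² ≥ 0` (the Newton inequality `σ₂ ≤ (3/8)σ₁²` of the source).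
[cite: GurskyViaclovsky2003, Prop. 3] -/
theorem IsPathSolution.mul_exp_le_of_isMaxOn {u : M → ℝ} {t : ℝ} {q : M → ℝ}
    (hs : IsPathSolution g h u t q) (ht : t ≤ 1) {x₀ : M} (hx₀ : IsMaxOn u univ x₀) :
    q x₀ * Real.exp (4 * u x₀) ≤
      g.scalarCurvature x₀ ^ 2 * (1 / 24 + (1 - t) * (2 - t) / 6) := by
  have hE : finrank ℝ (EuclideanSpace ℝ (Fin 4)) = 4 := finrank_euclideanSpace_fin
  have hn2 : (2 : ℕ∞ω) ≤ ∞ := WithTop.coe_le_coe.mpr le_top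
  have hg : g.IsRiemannian := hs.isRiemannian_background
  have hh : h.IsRiemannian := hs.isRiemannian
  have hu : ContMDiff (𝓡 4) 𝓘(ℝ) ∞ u := hs.contMDiff
  -- `h = φ² g` with `φ = e^{-u}`
  set φ : M → ℝ := fun x ↦ Real.exp (-u x) with hφ
  have hφs : ContMDiff (𝓡 4) 𝓘(ℝ) ∞ φ := fun x ↦ Real.contDiff_exp.contDiffAt.comp_contMDiffAt (hu x).neg
  have hφpos : ∀ x, 0 < φ x := fun x ↦ Real.exp_pos _
  have hval : ∀ (x : M) (v w : TangentSpace (𝓡 4) x), h.val x v w = φ x ^ 2 * g.val x v w := by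
    intro x v w
    rw [hs.val_eq x v w, hφ]
    simp only
    rw [sq, ← Real.exp_add]
    congr 1
    ring
  -- `Δ_g φ (x₀) ≥ 0` at the minimum point `x₀` of `φ`
  have hmin : IsMinOn φ univ x₀ := fun x _ ↦ by
    show Real.exp (-u x₀) ≤ Real.exp (-u x)
    exact Real.exp_le_exp.mpr (neg_le_neg (hx₀ (mem_univ x)))
  have hΔφ : 0 ≤ g.dalembertian φ x₀ :=
    g.dalembertian_nonneg_of_isLocalMin ((hφs.of_le hn2) x₀) (hmin.isLocalMin univ_mem)
      fun v hv ↦ hg x₀ v hv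
  -- `0 < R_h(x₀) ≤ e^{2u(x₀)} R_g(x₀)`
  have hRpos : 0 < h.scalarCurvature x₀ := hs.scalarCurvature_pos x₀
  have hφ3 : 0 < φ x₀ ^ 3 := pow_pos (hφpos x₀) 3
  have hRh : h.scalarCurvature x₀ =
      (φ x₀ ^ 3)⁻¹ * (g.scalarCurvature x₀ * φ x₀ - 6 * g.dalembertian φ x₀) :=
    scalarCurvature_conformal_sq_four hE g h hφs hφpos hval x₀
  have hRle : h.scalarCurvature x₀ * φ x₀ ^ 2 ≤ g.scalarCurvature x₀ := by
    have h1 : h.scalarCurvature x₀ * φ x₀ ^ 3 =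
        g.scalarCurvature x₀ * φ x₀ - 6 * g.dalembertian φ x₀ := by
      have hφ0 : φ x₀ ≠ 0 := (hφpos x₀).ne'
      rw [hRh]
      field_simp
    nlinarith [hφpos x₀, mul_nonneg hΔφ (hφpos x₀).le]
  have hRg : 0 < g.scalarCurvature x₀ :=
    lt_of_lt_of_le (mul_pos hRpos (pow_pos (hφpos x₀) 2)) hRle
  -- `e^{2u} φ² = 1`
  have hexpφ : Real.exp (2 * u x₀) * φ x₀ ^ 2 = 1 := by
    rw [hφ]
    simp only
    rw [sq, ← Real.exp_add, ← Real.exp_add, show 2 * u x₀ + (-u x₀ + -u x₀) = 0 by ring,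
      Real.exp_zero]
  have hRle' : h.scalarCurvature x₀ ≤ Real.exp (2 * u x₀) * g.scalarCurvature x₀ := by
    have := mul_le_mul_of_nonneg_left hRle (Real.exp_pos (2 * u x₀)).le
    calc h.scalarCurvature x₀ = Real.exp (2 * u x₀) * φ x₀ ^ 2 * h.scalarCurvature x₀ := by
          rw [hexpφ, one_mul]
      _ = Real.exp (2 * u x₀) * (h.scalarCurvature x₀ * φ x₀ ^ 2) := by ring
      _ ≤ Real.exp (2 * u x₀) * g.scalarCurvature x₀ := this
  have hR2 : h.scalarCurvature x₀ ^ 2 ≤ Real.exp (4 * u x₀) * g.scalarCurvature x₀ ^ 2 := by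
    have h4 : Real.exp (4 * u x₀) = Real.exp (2 * u x₀) ^ 2 := by
      rw [sq, ← Real.exp_add]
      congr 1
      ring
    rw [h4, ← mul_pow]
    exact pow_le_pow_left₀ hRpos.le hRle' 2
  -- the path equation at `x₀` and the pointwise bound `P_t(h) ≤ R_h²(1/24 + (1−t)(2−t)/6)`
  have heq := hs.pathOperator_eq x₀
  have hσ := h.sigma2WeylSchouten_eq hn2 hE (hh x₀)
  have hW := h.weylNormSq_nonneg x₀
  have hEn := h.tracelessRicciNormSq_nonneg x₀
  have hc : 0 ≤ (1 - t) * (2 - t) := mul_nonneg (by linarith) (by linarith)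
  set A : ℝ := Real.exp (4 * u x₀) with hA
  have hA0 : 0 < A := Real.exp_pos _
  have h8 : Real.exp (8 * u x₀) = A * A := by
    rw [hA, ← Real.exp_add]
    congr 1
    ring
  unfold pathOperator at heq
  rw [h8] at heq
  -- `q A² = P_t(h)(x₀) ≤ R_h² (1/24 + (1−t)(2−t)/6) ≤ A R_g² (1/24 + (1−t)(2−t)/6)`
  have hk : 0 ≤ 1 / 24 + (1 - t) * (2 - t) / 6 := by positivity
  have h1 : q x₀ * (A * A) ≤ h.scalarCurvature x₀ ^ 2 * (1 / 24 + (1 - t) * (2 - t) / 6) := by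
    rw [← heq]
    nlinarith [mul_nonneg hc (sq_nonneg (h.scalarCurvature x₀))]
  have h2 : h.scalarCurvature x₀ ^ 2 * (1 / 24 + (1 - t) * (2 - t) / 6) ≤
      A * g.scalarCurvature x₀ ^ 2 * (1 / 24 + (1 - t) * (2 - t) / 6) :=
    mul_le_mul_of_nonneg_right hR2 hk
  have h3 : q x₀ * A * A ≤ g.scalarCurvature x₀ ^ 2 * (1 / 24 + (1 - t) * (2 - t) / 6) * A := by
    nlinarith
  exact le_of_mul_le_mul_right h3 hA0

/-- **Gursky–Viaclovsky's sup bound (2003, Prop. 3, with the Weyl weight): `u_t ≤ δ̄(g)` uniformly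
in `t ∈ [δ, 1]`.** On a compact `4`-manifold with a `C^∞` background metric `g`, for a continuous
positive right-hand side `q` and `δ ∈ ℝ` there is a constant `C` — depending only on `g`, `q`, `δ` —
such that every smooth admissible solution `h = e^{−2u} g` of the weighted path equation at any
`t ∈ [δ, 1]` satisfies `u ≤ C` everywhere. (At a maximum point `x₀` of `u`,
`q(x₀)e^{4u(x₀)} ≤ R_g(x₀)²(1/24 + (1−δ)(2−δ)/6)` by `IsPathSolution.mul_exp_le_of_isMaxOn`, and
`4u < e^{4u}`.) [cite: GurskyViaclovsky2003, Prop. 3] -/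
theorem exists_forall_isPathSolution_le [CompactSpace M] {q : M → ℝ} (hq : Continuous q)
    (hq0 : ∀ x, 0 < q x) (δ : ℝ) :
    ∃ C : ℝ, ∀ t : ℝ, δ ≤ t → t ≤ 1 →
      ∀ (h : PseudoRiemannianMetric (𝓡 4) ∞ (EuclideanSpace ℝ (Fin 4)) (TangentSpace (𝓡 4) : M → Type _))
        [h.HasLeviCivita] (u : M → ℝ), IsPathSolution g h u t q → ∀ x, u x ≤ C := by
  rcases isEmpty_or_nonempty M with hM | hM
  · exact ⟨0, fun t _ _ h _ u _ x ↦ (hM.false x).elim⟩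
  -- bounds `R_g² ≤ B` and `q ≥ m > 0` on the compact manifold
  have hRc : Continuous fun x ↦ g.scalarCurvature x ^ 2 := g.contMDiff_scalarCurvature.continuous.pow 2
  obtain ⟨x₁, -, hx₁⟩ := isCompact_univ.exists_isMaxOn univ_nonempty hRc.continuousOn
  obtain ⟨x₂, -, hx₂⟩ := isCompact_univ.exists_isMinOn univ_nonempty hq.continuousOn
  set B : ℝ := g.scalarCurvature x₁ ^ 2 with hB
  set m : ℝ := q x₂ with hm
  have hm0 : 0 < m := hq0 x₂
  have hBle : ∀ x, g.scalarCurvature x ^ 2 ≤ B := fun x ↦ hx₁ (mem_univ x)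
  have hmle : ∀ x, m ≤ q x := fun x ↦ hx₂ (mem_univ x)
  have hB0 : 0 ≤ B := sq_nonneg _
  set k : ℝ := 1 / 24 + (1 - δ) * (2 - δ) / 6 with hk
  refine ⟨B * |k| / m / 4, fun t hδt ht1 h _ u hs x ↦ ?_⟩
  -- a maximum point of the continuous function `u`
  obtain ⟨x₀, -, hx₀⟩ := isCompact_univ.exists_isMaxOn univ_nonempty hs.contMDiff.continuous.continuousOn
  have hpt := IsPathSolution.mul_exp_le_of_isMaxOn g h hs ht1 hx₀
  have hkt : 1 / 24 + (1 - t) * (2 - t) / 6 ≤ |k| := by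
    refine le_trans ?_ (le_abs_self k)
    rw [hk]
    nlinarith
  have hkt0 : 0 ≤ 1 / 24 + (1 - t) * (2 - t) / 6 := by
    have : 0 ≤ (1 - t) * (2 - t) := mul_nonneg (by linarith) (by linarith)
    positivity
  -- `m e^{4u(x₀)} ≤ q(x₀) e^{4u(x₀)} ≤ B |k|`
  have h1 : m * Real.exp (4 * u x₀) ≤ B * |k| :=
    calc m * Real.exp (4 * u x₀) ≤ q x₀ * Real.exp (4 * u x₀) :=
          mul_le_mul_of_nonneg_right (hmle x₀) (Real.exp_pos _).le
      _ ≤ g.scalarCurvature x₀ ^ 2 * (1 / 24 + (1 - t) * (2 - t) / 6) := hpt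
      _ ≤ B * |k| := mul_le_mul (hBle x₀) hkt hkt0 hB0
  have h2 : 4 * u x₀ < Real.exp (4 * u x₀) := by linarith [Real.add_one_le_exp (4 * u x₀)]
  have h3 : m * (4 * u x₀) < B * |k| := lt_of_lt_of_le (mul_lt_mul_of_pos_left h2 hm0) h1
  have h4 : u x₀ ≤ B * |k| / m / 4 := by
    rw [div_div, le_div_iff₀ (by positivity)]
    nlinarith
  exact le_trans (hx₀ (mem_univ x)) h4

end SupBound

/-! ### The integral identity of Prop. 4, Lemma 1, and the lower bound on `max u` -/

section Integral

variable {M : Type*} [TopologicalSpace M] [T2Space M] [SecondCountableTopology M] [CompactSpace M]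
  [ChartedSpace (EuclideanSpace ℝ (Fin 4)) M] [IsManifold (𝓡 4) ∞ M]
  [MeasurableSpace M] [BorelSpace M]
  (g h : PseudoRiemannianMetric (𝓡 4) ∞ (EuclideanSpace ℝ (Fin 4)) (TangentSpace (𝓡 4) : M → Type _))
  [g.HasLeviCivita] [h.HasLeviCivita]

omit [SecondCountableTopology M] in
/-- **`(∫ f dμ)² ≤ μ(X) ∫ f² dμ`** for a continuous real function on a compact space with a finite
measure (Cauchy–Schwarz against `1`, here from `∫ (f − c)² dμ ≥ 0` with `c` the mean of `f`).
[folklore] -/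
theorem sq_integral_le_measureReal_mul_integral_sq {X : Type*} [TopologicalSpace X] [CompactSpace X]
    [MeasurableSpace X] [OpensMeasurableSpace X] {μ : Measure X} [IsFiniteMeasure μ] {f : X → ℝ}
    (hf : Continuous f) :
    (∫ x, f x ∂μ) ^ 2 ≤ μ.real univ * ∫ x, f x ^ 2 ∂μ := by
  set V : ℝ := μ.real univ with hV
  set P : ℝ := ∫ x, f x ∂μ with hP
  set Q : ℝ := ∫ x, f x ^ 2 ∂μ with hQ
  have hV0 : 0 ≤ V := measureReal_nonneg
  have hQ0 : 0 ≤ Q := integral_nonneg fun x ↦ sq_nonneg _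
  have hint : ∀ n : ℕ, Integrable (fun x ↦ f x ^ n) μ := fun n ↦
    (hf.pow n).integrable_of_hasCompactSupport (isClosed_tsupport _).isCompact
  have hint1 : Integrable f μ := by simpa using hint 1
  -- `0 ≤ ∫ (f − c)² = Q − 2cP + c²V` for every real `c`
  have hexp : ∀ c : ℝ, 0 ≤ Q - 2 * c * P + c ^ 2 * V := by
    intro c
    have h0 : 0 ≤ ∫ x, (f x - c) ^ 2 ∂μ := integral_nonneg fun x ↦ sq_nonneg _
    have h1 : ∫ x, (f x - c) ^ 2 ∂μ = Q - 2 * c * P + c ^ 2 * V := by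
      have heq : (fun x ↦ (f x - c) ^ 2) = fun x ↦ f x ^ 2 - 2 * c * f x + c ^ 2 := by
        funext x
        ring
      have i1 : Integrable (fun x ↦ f x ^ 2) μ := hint 2
      have i2 : Integrable (fun x ↦ 2 * c * f x) μ := hint1.const_mul _
      have i3 : Integrable (fun x ↦ f x ^ 2 - 2 * c * f x) μ := i1.sub i2
      have i4 : Integrable (fun _ : X ↦ c ^ 2) μ := integrable_const _
      rw [heq, integral_add i3 i4, integral_sub i1 i2, integral_const_mul, integral_const, hV,
        smul_eq_mul]
      ring
    linarith
  rcases eq_or_lt_of_le hV0 with hV00 | hVpos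
  · -- `μ = 0`
    have hμ : μ = 0 := by
      rw [← Measure.measure_univ_eq_zero]
      have h1 : (μ univ).toReal = 0 := by rw [← measureReal_def]; exact hV00.symm
      exact (ENNReal.toReal_eq_zero_iff _ |>.1 h1).resolve_right (measure_ne_top μ univ)
    simp [hP, hQ, hμ]
  · have h := hexp (P / V)
    have h1 : Q - 2 * (P / V) * P + (P / V) ^ 2 * V = Q - P ^ 2 / V := by
      field_simp
      ring
    rw [h1, sub_nonneg, div_le_iff₀ hVpos] at h
    linarith

/-- **Gursky–Viaclovsky's Lemma 1 (2003, §3): `∫ R_h² dV_h ≥ Y[g]²` for every `h ∈ [g]` when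
`Y[g] ≥ 0`** (Hölder: `Y[g] ≤ Q(h) = ∫R_h dV_h / Vol(h)^{1/2}` by the definition of the Yamabe
constant as an infimum over the conformal class, `yamabeConstant_le_yamabeQuotient`, and
`(∫R_h dV_h)² ≤ Vol(h) ∫R_h² dV_h`). For `C^∞` Riemannian metrics on a closed `4`-manifold.
[cite: GurskyViaclovsky2003, Lemma 1] -/
theorem sq_yamabeConstant_le_integral_scalarCurvature_sq (hg : g.IsRiemannian)
    (hh : h.IsRiemannian)
    (hconf : IsConformalTo (h.toContMDiffRiemannianMetric hh) (g.toContMDiffRiemannianMetric hg))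
    (hY : 0 ≤ yamabeConstant (g.toContMDiffRiemannianMetric hg)) :
    yamabeConstant (g.toContMDiffRiemannianMetric hg) ^ 2 ≤
      ∫ x, h.scalarCurvature x ^ 2 ∂(riemannianMeasure (h.toContMDiffRiemannianMetric hh)) := by
  set H₀ := h.toContMDiffRiemannianMetric hh with hH₀
  haveI hLC : (ofRiemannian (g.toContMDiffRiemannianMetric hg)).HasLeviCivita := ‹g.HasLeviCivita›
  haveI hLC' : (ofRiemannian H₀).HasLeviCivita := ‹h.HasLeviCivita›
  set ν : Measure M := riemannianMeasure H₀ with hν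
  haveI : IsFiniteMeasure ν := isFiniteMeasure_riemannianMeasure H₀
  have hE : finrank ℝ (EuclideanSpace ℝ (Fin 4)) = 4 := finrank_euclideanSpace_fin
  have hYQ : yamabeConstant (g.toContMDiffRiemannianMetric hg) ≤ yamabeQuotient H₀ :=
    yamabeConstant_le_yamabeQuotient H₀ hconf
  rw [yamabeQuotient_eq_div_sqrt hE H₀] at hYQ
  have hCS := sq_integral_le_measureReal_mul_integral_sq (μ := ν)
    (f := fun x ↦ h.scalarCurvature x) h.contMDiff_scalarCurvature.continuous
  set V : ℝ := ν.real univ with hV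
  set P : ℝ := ∫ x, h.scalarCurvature x ∂ν with hP
  set Q : ℝ := ∫ x, h.scalarCurvature x ^ 2 ∂ν with hQ
  have hV0 : 0 ≤ V := measureReal_nonneg
  have hQ0 : 0 ≤ Q := integral_nonneg fun x ↦ sq_nonneg _
  have hT : totalScalarCurvature H₀ = P := rfl
  have hVr : (riemannianMeasure H₀ univ).toReal = V := rfl
  rw [hT, hVr] at hYQ
  -- `Y ≤ P/√V`, so `Y² ≤ P²/V ≤ Q`
  have h1 : yamabeConstant (g.toContMDiffRiemannianMetric hg) ^ 2 ≤ (P / Real.sqrt V) ^ 2 :=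
    pow_le_pow_left₀ hY hYQ 2
  rw [div_pow, Real.sq_sqrt hV0] at h1
  refine h1.trans ?_
  rcases eq_or_lt_of_le hV0 with hV00 | hVpos
  · rw [← hV00, div_zero]
    exact hQ0
  · rw [div_le_iff₀ hVpos]
    linarith

omit [g.HasLeviCivita] in
/-- **The integral identity of Gursky–Viaclovsky's Prop. 4 (2003, §3), Weyl-weighted and read on the
conformal metric**: for a path solution `h = e^{−2u} g` of `P_t(h) = q e^{8u}` on a closed
`4`-manifold,
`∫_M q e^{4u} dV_g = κ(h) + ((1−t)(2−t)/6) ∫_M R_h² dV_h`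
— integrate the equation against `dV_h = e^{−4u} dV_g` (`riemannianMeasure_of_conformal`):
`∫ P_t(h) dV_h = ∫σ₂(A_h) dV_h − ¼∫|W_h|² dV_h + ((1−t)(2−t)/6)∫R_h² dV_h = κ(h) + …`
(`sigma2WeylSchoutenIntegral_eq`, `weylEnergy_eq_ofReal_integral`). In the source this is
"`∫ f² e^{4u} = ∫ σ₂(g̃⁻¹A¹_{g̃}) dvol_{g̃} + (1/24)(1−t)(2−t)∫R_{g̃}² dvol_{g̃}`" (their
`σ₂(A^t) = ¼ P_t + (1/16)|W|²`). [cite: GurskyViaclovsky2003, Prop. 4 (proof)] -/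
theorem IsPathSolution.integral_mul_exp_eq {u : M → ℝ} {t : ℝ} {q : M → ℝ}
    (hs : IsPathSolution g h u t q) (hg : g.IsRiemannian) (hh : h.IsRiemannian) :
    ∫ x, q x * Real.exp (4 * u x) ∂(riemannianMeasure (g.toContMDiffRiemannianMetric hg)) =
      kappa h + (1 - t) * (2 - t) / 6 *
        ∫ x, h.scalarCurvature x ^ 2 ∂(riemannianMeasure (h.toContMDiffRiemannianMetric hh)) := by
  set G₀ := g.toContMDiffRiemannianMetric hg with hG₀
  set H₀ := h.toContMDiffRiemannianMetric hh with hH₀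
  haveI hLC' : (ofRiemannian H₀).HasLeviCivita := ‹h.HasLeviCivita›
  set μ : Measure M := riemannianMeasure G₀ with hμ
  haveI : IsFiniteMeasure μ := isFiniteMeasure_riemannianMeasure G₀
  haveI : IsFiniteMeasure (riemannianMeasure H₀) := isFiniteMeasure_riemannianMeasure H₀
  have hE : finrank ℝ (EuclideanSpace ℝ (Fin 4)) = 4 := finrank_euclideanSpace_fin
  have hu : ContMDiff (𝓡 4) 𝓘(ℝ) ∞ u := hs.contMDiff
  -- (1) `∫ P_t(h) dν = κ(h) + ((1−t)(2−t)/6) ∫ R_h² dν`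
  obtain ⟨hWi, hWE⟩ := h.weylEnergy_eq_ofReal_integral hh hE
  have hσi := h.integrable_sigma2WeylSchouten hh hE
  have hRi : Integrable (fun x ↦ h.scalarCurvature x ^ 2) (riemannianMeasure H₀) :=
    integrable_of_continuous H₀ (h.contMDiff_scalarCurvature.continuous.pow 2)
  have hkappa : kappa h = ∫ x, h.sigma2WeylSchouten x ∂(riemannianMeasure H₀) - 1 / 4 * ∫ x, h.weylNormSq x ∂(riemannianMeasure H₀) := by
    rw [kappa, hWE, ENNReal.toReal_ofReal (integral_nonneg fun x ↦ h.weylNormSq_nonneg x),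
      h.sigma2WeylSchoutenIntegral_eq hh]
  have hW4 : Integrable (fun x ↦ 1 / 4 * h.weylNormSq x) (riemannianMeasure H₀) := hWi.const_mul _
  have hP1 : Integrable (fun x ↦ h.sigma2WeylSchouten x - 1 / 4 * h.weylNormSq x) (riemannianMeasure H₀) := hσi.sub hW4
  have hP2 : Integrable (fun x ↦ (1 - t) * (2 - t) * h.scalarCurvature x ^ 2 / 6) (riemannianMeasure H₀) :=
    (hRi.const_mul ((1 - t) * (2 - t) / 6)).congr (ae_of_all _ fun x ↦ by simp only; ring)
  have hP : ∫ x, pathOperator h t x ∂(riemannianMeasure H₀) =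
      kappa h + (1 - t) * (2 - t) / 6 * ∫ x, h.scalarCurvature x ^ 2 ∂(riemannianMeasure H₀) := by
    simp only [pathOperator]
    rw [integral_add hP1 hP2, integral_sub hσi hW4, integral_const_mul, hkappa]
    congr 1
    rw [← integral_const_mul]
    refine integral_congr_ae (ae_of_all _ fun x ↦ ?_)
    simp only
    ring
  -- (2) `dν = e^{−4u} dμ`
  have hvol : riemannianMeasure H₀ = μ.withDensity fun x ↦ ENNReal.ofReal (Real.exp (-4 * u x)) := by
    have h1 := riemannianMeasure_of_conformal H₀ G₀ (φ := fun x ↦ Real.exp (-2 * u x))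
      (fun x v v' ↦ hs.val_eq x v v')
    rw [h1]
    congr 1
    funext x
    congr 1
    have h4 : Real.exp (-4 * u x) = Real.exp (-2 * u x) ^ 2 := by
      rw [sq, ← Real.exp_add]
      congr 1
      ring
    rw [show Real.exp (-2 * u x) ^ 4 = (Real.exp (-4 * u x)) ^ 2 by rw [h4]; ring,
      Real.sqrt_sq (Real.exp_pos _).le]
  have hdens_meas : Measurable fun x ↦ ENNReal.ofReal (Real.exp (-4 * u x)) :=
    ENNReal.measurable_ofReal.comp
      (Real.continuous_exp.comp (continuous_const.mul hu.continuous)).measurable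
  have hdens_lt : ∀ᵐ x ∂μ, ENNReal.ofReal (Real.exp (-4 * u x)) < ⊤ :=
    ae_of_all _ fun _ ↦ ENNReal.ofReal_lt_top
  -- (3) `∫ P_t(h) dν = ∫ e^{−4u} q e^{8u} dμ = ∫ q e^{4u} dμ`
  have hI : ∫ x, pathOperator h t x ∂(riemannianMeasure H₀) = ∫ x, q x * Real.exp (4 * u x) ∂μ := by
    rw [hvol, integral_withDensity_eq_integral_toReal_smul hdens_meas hdens_lt]
    refine integral_congr_ae (ae_of_all _ fun x ↦ ?_)
    simp only [ENNReal.toReal_ofReal (Real.exp_pos _).le, smul_eq_mul]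
    rw [hs.pathOperator_eq x, mul_left_comm, ← Real.exp_add]
    congr 2
    ring
  rw [← hI, hP]

/-- **`κ(h) ≤ ∫ q e^{4u} dV_g` along the path for `t ≤ 1`** (the `R_h²` term of
`IsPathSolution.integral_mul_exp_eq` is non-negative), and with Lemma 1:
`κ(h) + ((1−t)(2−t)/6) Y[g]² ≤ ∫ q e^{4u} dV_g` when `Y[g] ≥ 0` — the inequality
"`C' ∫ e^{4u_t} dvol_g ≥ λ_t`" of the proof of Gursky–Viaclovsky 2003, Prop. 4.
[cite: GurskyViaclovsky2003, Prop. 4 (proof)] -/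
theorem IsPathSolution.kappa_add_le_integral_mul_exp {u : M → ℝ} {t : ℝ} {q : M → ℝ}
    (hs : IsPathSolution g h u t q) (ht : t ≤ 1) (hg : g.IsRiemannian) (hh : h.IsRiemannian)
    (hY : 0 ≤ yamabeConstant (g.toContMDiffRiemannianMetric hg)) :
    kappa h + (1 - t) * (2 - t) / 6 * yamabeConstant (g.toContMDiffRiemannianMetric hg) ^ 2 ≤
      ∫ x, q x * Real.exp (4 * u x) ∂(riemannianMeasure (g.toContMDiffRiemannianMetric hg)) := by
  rw [hs.integral_mul_exp_eq g h hg hh]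
  have hc : 0 ≤ (1 - t) * (2 - t) / 6 := by
    have : 0 ≤ (1 - t) * (2 - t) := mul_nonneg (by linarith) (by linarith)
    positivity
  have hconf : IsConformalTo (h.toContMDiffRiemannianMetric hh) (g.toContMDiffRiemannianMetric hg) :=
    ⟨fun x ↦ Real.exp (-2 * u x), fun x ↦ ⟨Real.exp_pos _, fun v w ↦ hs.val_eq x v w⟩⟩
  have hL := sq_yamabeConstant_le_integral_scalarCurvature_sq g h hg hh hconf hY
  nlinarith [mul_le_mul_of_nonneg_left hL hc]

omit [g.HasLeviCivita] in
/-- **The lower bound on `max u` (first half of Gursky–Viaclovsky 2003, Prop. 4, Weyl-weighted):** if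
along the path (`t ≤ 1`) the conformal invariant is bounded below, `κ(h) ≥ κ₀ > 0`, then
`κ₀ ≤ ∫ q e^{4u} dV_g ≤ e^{4 max u} ∫ q dV_g`, so some point `x` has
`log(κ₀ / ∫ q dV_g) ≤ 4 u(x)` — `u` cannot be uniformly very negative ("`u_t > δ̲` … depends only
upon `g, C₁` and `log λ_t`"). (The second half, the
passage from `max u` to `min u` under a gradient bound, is the Harnack step of the source and is not
formalised here.) For `q > 0` continuous on a non-empty closed `4`-manifold.
[cite: GurskyViaclovsky2003, Prop. 4 (proof)] -/
theorem IsPathSolution.exists_log_le [Nonempty M] {u : M → ℝ} {t : ℝ} {q : M → ℝ}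
    (hs : IsPathSolution g h u t q) (ht : t ≤ 1) (hg : g.IsRiemannian)
    (hq : Continuous q) (hq0 : ∀ x, 0 < q x) {κ₀ : ℝ} (hκ0 : 0 < κ₀) (hκ : κ₀ ≤ kappa h) :
    ∃ x, Real.log (κ₀ / ∫ y, q y ∂(riemannianMeasure (g.toContMDiffRiemannianMetric hg))) ≤
      4 * u x := by
  set G₀ := g.toContMDiffRiemannianMetric hg with hG₀
  set μ : Measure M := riemannianMeasure G₀ with hμ
  haveI : IsFiniteMeasure μ := isFiniteMeasure_riemannianMeasure G₀
  have hh : h.IsRiemannian := hs.isRiemannian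
  have hu : ContMDiff (𝓡 4) 𝓘(ℝ) ∞ u := hs.contMDiff
  -- a maximum point `x₀` of `u`
  obtain ⟨x₀, -, hx₀⟩ := isCompact_univ.exists_isMaxOn univ_nonempty hu.continuous.continuousOn
  refine ⟨x₀, ?_⟩
  -- `κ₀ ≤ κ(h) ≤ ∫ q e^{4u} dμ ≤ e^{4u(x₀)} ∫ q dμ`
  have hqi : Integrable q μ := integrable_of_continuous G₀ hq
  have hqei : Integrable (fun x ↦ q x * Real.exp (4 * u x)) μ :=
    integrable_of_continuous G₀ (hq.mul (Real.continuous_exp.comp (continuous_const.mul hu.continuous)))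
  have h1 : kappa h ≤ ∫ x, q x * Real.exp (4 * u x) ∂μ := by
    rw [hs.integral_mul_exp_eq g h hg hh]
    have hc : 0 ≤ (1 - t) * (2 - t) / 6 := by
      have : 0 ≤ (1 - t) * (2 - t) := mul_nonneg (by linarith) (by linarith)
      positivity
    have hR0 : 0 ≤ ∫ x, h.scalarCurvature x ^ 2
        ∂(riemannianMeasure (h.toContMDiffRiemannianMetric hh)) :=
      integral_nonneg fun x ↦ sq_nonneg _
    nlinarith [mul_nonneg hc hR0]
  have h2 : ∫ x, q x * Real.exp (4 * u x) ∂μ ≤ Real.exp (4 * u x₀) * ∫ x, q x ∂μ := by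
    rw [← integral_const_mul]
    refine integral_mono hqei (hqi.const_mul _) fun x ↦ ?_
    have hux : u x ≤ u x₀ := isMaxOn_iff.1 hx₀ x (mem_univ x)
    simp only
    rw [mul_comm]
    exact mul_le_mul_of_nonneg_right (Real.exp_le_exp.2 (by linarith)) (hq0 x).le
  -- `∫ q dμ > 0`
  have hqpos : 0 < ∫ x, q x ∂μ := by
    obtain ⟨x₂, -, hx₂⟩ := isCompact_univ.exists_isMinOn univ_nonempty hq.continuousOn
    have hm : ∀ x, q x₂ ≤ q x := fun x ↦ hx₂ (mem_univ x)
    have hvol : 0 < μ.real univ := by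
      rw [measureReal_def, ENNReal.toReal_pos_iff]
      exact ⟨pos_iff_ne_zero.2
        ((isOpenPosMeasure_riemannianMeasure G₀).open_pos univ isOpen_univ univ_nonempty),
        measure_lt_top μ univ⟩
    calc (0 : ℝ) < q x₂ * μ.real univ := mul_pos (hq0 x₂) hvol
      _ = ∫ _, q x₂ ∂μ := by rw [integral_const, smul_eq_mul, mul_comm]
      _ ≤ ∫ x, q x ∂μ := integral_mono (integrable_const _) hqi hm
  have h3 : κ₀ / ∫ x, q x ∂μ ≤ Real.exp (4 * u x₀) := by
    rw [div_le_iff₀ hqpos]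
    linarith
  calc Real.log (κ₀ / ∫ x, q x ∂μ) ≤ Real.log (Real.exp (4 * u x₀)) :=
        Real.log_le_log (div_pos hκ0 hqpos) h3
    _ = 4 * u x₀ := Real.log_exp _

end Integral

end Literature.Geometry.Riemannian.GurskyViaclovskyPath

end
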